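import Summits.BirchSwinnertonDyer.BirchSwinnertonDyer.Theorems.ManinLocalTwoThreeAtkinLehnerStep
import Summits.BirchSwinnertonDyer.BirchSwinnertonDyer.Theorems.ManinLocalTwoThreeHeckeAdLowerUnipotent
import HarnessLib

/-!
# E-es-37 `ShiftInvariantDescentTwo` for `j ≥ 2` (the index-2 descent at `t = 2`), part 1: `g = U⁻(2^{j−1}L′)`-stability
# of a `2`-shift-invariant generalised eigen-homomorphism on `Γ₀(2^jL′)`

Summit `BirchSwinnertonDyer`, route `ManinLocalTwoThree` (cell bsd-f2-manin), crux C2 `ManinOddAtFour` (stmt-BirchSwinnertonDyer-22967),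
line `kato_shift_two` v6, stub 3 (`C₃`-image residual), descent step [D] = E-es-37 of MEMO-es §25.3/§25.9 at `t = 2`, `j ≥ 2`:
`Γ₀(2^jL′) ◁ Γ₀(2^{j−1}L′)` has index `2` with the non-trivial coset represented by `g = U⁻(2^{j−1}L′) = (1 0; 2^{j−1}L′ 1)`.
This file (the lead p1's draft HOME/p1/DescentTwo.lean, checked and landed by p2 after the lead's session ended, INBOX
2026-08-28T05:06:53Z) proves the STABILITY half: for `L′` odd, `K` of characteristic `p`, `S ∋` the primes of `2pL′`, a
`2`-shift-invariant generalised `λ`-eigen cocycle `u` on `Γ₀(2^jL′)` with hNT(2) satisfies `u(gγg⁻¹) = u(γ)` for all `γ`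
(`adLowerUnip_invariant`).  Route (§25.9 (i)): `c := u∘Ad(g) − u` is a cocycle (`adLowerUnip_mem_cocycles`) and again
generalised `λ`-eigen (`isHeckeGenEigenvector_adLowerUnip`, from p2's σ2(a1) identity `heckeU_zero_lowerUnip_conj`); it kills
`Γ₀(2^jL′) ∩ Γ(2^e)` because conjugation by `ι g ∈ Δ_2(L′)` preserves `u` on deep elements (`exists_good_of_mem_Delta`, p1), so
LEMMA C (`heckeU_eq_smul_of_kills_congruence`, modulus `2^e`) makes it a `T_r`-eigenvector with eigenvalue `r + 1` for
`r ≡ 1 (2^e)`, and hNT(2) + `eq_of_apply_eq_smul_of_mem_maxGenEigenspace` force `c = 0`.  Part 2 (the extension across the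
index-`2` step via `extTwo`, shift-invariance, uniqueness, Hecke and cusps) follows in `…DescentTwoExtension.lean`.
No new definitions; nothing about BSD or Manin's conjecture is proved here.

References: G. Shimura (1971) §8.3 [cite: Shimura1971, §8.3 (8.3.2)]; J.-P. Serre, *Trees*, II.1.4; cell memo HOME/MEMO-es.md
§25.3 (D), §25.9 (i); HOME/p1/NOTES-p1-g2.md (FINAL HANDOFF).
-/

set_option autoImplicit false
set_option linter.dupNamespace false

open scoped MatrixGroups

open CongruenceSubgroup Matrix.SpecialLinearGroup Literature.NumberTheory.EllipticCurves.ModularForms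
  Literature.NumberTheory.EllipticCurves.ModularForms.HidaCohomology
  Summit.BirchSwinnertonDyer.BirchSwinnertonDyer.Theorems.ConjSpanGenAllLevels

namespace Summit.BirchSwinnertonDyer.BirchSwinnertonDyer.Theorems.ManinLocalTwoThree

/-! ### Generalised eigenvectors transported along the conjugation `Ad(U)` (from p2's σ2(a1) identity) -/

section AdTransport

variable {x : ℤ} {U : SL(2, ℤ)} (hU : (U : Matrix (Fin 2) (Fin 2) ℤ) = !![1, 0; x, 1]) {N : ℕ}
  (hN : (N : ℤ) = 2 * x) (hx : (2 : ℤ) ∣ x)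

include hU hN hx

/-- `u ∘ Ad(U)` is a cocycle when `u` is (`U = U⁻(x)` normalises `Γ₀(2x)`). [folklore] -/
theorem adLowerUnip_mem_cocycles {K : Type*} [CommRing K] {u : Gamma0 N → Fin 1 → K} (hu : u ∈ cocycles 0 N K) :
    (fun δ : Gamma0 N ↦ u ⟨U * (δ : SL(2, ℤ)) * U⁻¹, (mem_Gamma0_iff_lowerUnip_conj hU hN hx δ).mp δ.2⟩) ∈
      cocycles 0 N K := by
  rw [mem_cocycles_iff]
  intro γ δ
  have hmul : (⟨U * ((γ * δ : Gamma0 N) : SL(2, ℤ)) * U⁻¹, (mem_Gamma0_iff_lowerUnip_conj hU hN hx (γ * δ)).mp (γ * δ).2⟩ :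
      Gamma0 N) = ⟨U * (γ : SL(2, ℤ)) * U⁻¹, (mem_Gamma0_iff_lowerUnip_conj hU hN hx γ).mp γ.2⟩ *
        ⟨U * (δ : SL(2, ℤ)) * U⁻¹, (mem_Gamma0_iff_lowerUnip_conj hU hN hx δ).mp δ.2⟩ := by
    apply Subtype.ext
    show U * ((γ * δ : Gamma0 N) : SL(2, ℤ)) * U⁻¹ = (U * (γ : SL(2, ℤ)) * U⁻¹) * (U * (δ : SL(2, ℤ)) * U⁻¹)
    rw [Subgroup.coe_mul]; group
  show u _ = u _ + act 0 (gmat δ) (u _)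
  rw [hmul, cocycle_zero_mul hu, act_zero_eq_id, LinearMap.id_apply, add_comm]

/-- **σ2(a1) transported to generalised eigenvectors**: if `u` is a generalised `λ`-eigenvector off `S` (`2 ∈ S`), so is
`u ∘ Ad(U)` — from p2's identity `T_r (u ∘ Ad U) = (T_r u) ∘ Ad U` (`heckeU_zero_lowerUnip_conj`) by induction on the
nilpotency exponent. [folklore] -/
theorem isHeckeGenEigenvector_adLowerUnip [NeZero N] {K : Type*} [Field K] {S : Finset ℕ} (h2S : 2 ∈ S) {lam : ℕ → K}
    {u : cocycles 0 N K} (hu : IsHeckeGenEigenvector S lam u) :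
    IsHeckeGenEigenvector S lam ⟨_, adLowerUnip_mem_cocycles hU hN hx u.2⟩ := by
  intro r _ hr hrS
  have hr2 : r ≠ 2 := fun h ↦ hrS (h ▸ h2S)
  have hmem := hu r hr hrS
  rw [Module.End.mem_maxGenEigenspace] at hmem ⊢
  obtain ⟨k, hk⟩ := hmem
  refine ⟨k, ?_⟩
  -- `((T − λ)^k (v ∘ Ad U)) = ((T − λ)^k v) ∘ Ad U` for every cocycle `v`
  have key : ∀ (m : ℕ) (v : cocycles 0 N K),
      ((((heckeUZ 0 N K hr - lam r • (1 : Module.End K (cocycles 0 N K))) ^ m)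
        ⟨_, adLowerUnip_mem_cocycles hU hN hx v.2⟩ : cocycles 0 N K) : Gamma0 N → Fin 1 → K) =
      fun δ : Gamma0 N ↦ ((((heckeUZ 0 N K hr - lam r • (1 : Module.End K (cocycles 0 N K))) ^ m) v : cocycles 0 N K) :
        Gamma0 N → Fin 1 → K) ⟨U * (δ : SL(2, ℤ)) * U⁻¹, (mem_Gamma0_iff_lowerUnip_conj hU hN hx δ).mp δ.2⟩ := by
    intro m
    induction m with
    | zero => intro v; rfl
    | succ m ih =>
      intro v
      rw [pow_succ', Module.End.mul_apply, Module.End.mul_apply]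
      set w : cocycles 0 N K := ((heckeUZ 0 N K hr - lam r • (1 : Module.End K (cocycles 0 N K))) ^ m) v with hw
      have ihv := ih v
      rw [← hw] at ihv
      -- the element `(T-λ)^m (v ∘ Ad U)` IS `w ∘ Ad U`
      have helt : ((heckeUZ 0 N K hr - lam r • (1 : Module.End K (cocycles 0 N K))) ^ m)
          ⟨_, adLowerUnip_mem_cocycles hU hN hx v.2⟩ = ⟨_, adLowerUnip_mem_cocycles hU hN hx w.2⟩ :=
        Subtype.ext ihv
      rw [helt]
      funext δ
      simp only [LinearMap.sub_apply, LinearMap.smul_apply, Module.End.one_apply, Submodule.coe_sub, Submodule.coe_smul,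
        coe_heckeUZ, Pi.sub_apply, Pi.smul_apply]
      rw [heckeU_zero_lowerUnip_conj hU hN hx hr hr2 w.2 δ]
  apply Subtype.ext
  rw [key k u, hk]
  rfl

end AdTransport

/-! ### The element `g = U⁻(2^{j−1}L′)` and the levels `2^{j−1}L′ ∣ 2^jL′` -/

section Levels

variable (L' j : ℕ)

/-- `2^j L′ = 2 · 2^{j−1} L′` for `j ≥ 1` (plumbing). [folklore] -/
theorem level_eq_two_mul (hj : 1 ≤ j) : ((L' * 2 ^ j : ℕ) : ℤ) = 2 * ((L' : ℤ) * 2 ^ (j - 1)) := by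
  obtain ⟨i, rfl⟩ := Nat.exists_eq_add_of_le hj
  rw [Nat.add_sub_cancel_left]
  push_cast
  ring

/-- `2 ∣ 2^{j−1} L′` for `j ≥ 2` (plumbing). [folklore] -/
theorem two_dvd_half_level (hj : 2 ≤ j) : (2 : ℤ) ∣ (L' : ℤ) * 2 ^ (j - 1) := by
  obtain ⟨i, rfl⟩ := Nat.exists_eq_add_of_le hj
  exact Dvd.dvd.mul_left (dvd_pow_self 2 (by omega)) _

/-- `Γ₀(2^jL′) ≤ Γ₀(2^{j−1}L′)`. [folklore] -/
theorem Gamma0_level_le (hj : 1 ≤ j) : Gamma0 (L' * 2 ^ j) ≤ Gamma0 (L' * 2 ^ (j - 1)) := by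
  intro γ hγ
  apply mem_Gamma0_of_dvd_apply_one_zero
  have h := ManinFrameResidueProperRTameTwist.natCast_dvd_entry10 ⟨γ, hγ⟩
  have hdvd : ((L' * 2 ^ (j - 1) : ℕ) : ℤ) ∣ ((L' * 2 ^ j : ℕ) : ℤ) := by
    rw [level_eq_two_mul L' j hj]; push_cast; exact Dvd.intro_left _ rfl
  exact hdvd.trans h

/-- The matrix `U⁻(x) = (1 0; x 1)` as an element of `SL₂(ℤ)` lies in `Γ₀(M)` whenever `M ∣ x` (plumbing). [folklore] -/
theorem lowerUnipInt_mem_Gamma0 (M : ℕ) (x : ℤ) (h : (M : ℤ) ∣ x) :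
    (⟨!![1, 0; x, 1], by simp [Matrix.det_fin_two_of]⟩ : SL(2, ℤ)) ∈ Gamma0 M :=
  mem_Gamma0_of_dvd_apply_one_zero _ (by simpa using h)

end Levels

/-! ### `g`-stability of `u` on all of `Γ₀(2^jL′)` -/

section Stability

/-- **`u` is `Ad(U⁻(2^{j−1}L′))`-invariant on `Γ₀(2^jL′)`** (MEMO-es §25.9 (i) + «ε = 0»): for `j ≥ 2`, `L′` odd, a
`2`-shift-invariant generalised Hecke eigen-homomorphism `u` on `Γ₀(2^jL′)` with hNT(2) satisfies `u(UγU⁻¹) = u(γ)` for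
`U = U⁻(2^{j−1}L′)` and every `γ`.  Proof: `c := u∘Ad(U) − u` is generalised `λ`-eigen (σ2(a1), p2's
`heckeU_zero_lowerUnip_conj`), kills `Γ₀(2^jL′) ∩ Γ(2^e)` (conjugation by `ι U ∈ Δ_2(L′)` preserves `u` on deep elements:
`exists_good_of_mem_Delta`, p1), so LEMMA C (modulus `2^e`) + hNT(2) force `c = 0`. [folklore] -/
theorem adLowerUnip_invariant {p L' j : ℕ} {K : Type} [Field K] [CharP K p] [NeZero L'] (hL' : ¬ 2 ∣ L') (hj : 2 ≤ j)
    (S : Finset ℕ) (lam : ℕ → K) (u : cocycles 0 (L' * 2 ^ j) K)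
    (hS : ∀ q : ℕ, q.Prime → q ∣ p * 2 * L' → q ∈ S) (hgen : IsHeckeGenEigenvector S lam u)
    (hNT : ∀ M : ℕ, ∃ r : ℕ, r.Prime ∧ r ∉ S ∧ r ≡ 1 [MOD 2 ^ M] ∧ lam r ≠ (r : K) + 1)
    (hshift : degeneracyPullback 0 (L' * 2 ^ j) (L' * 2 ^ j * 2) 2 K dvd_rfl (u : Gamma0 (L' * 2 ^ j) → Fin 1 → K) =
      degeneracyPullback 0 (L' * 2 ^ j) (L' * 2 ^ j * 2) 1 K (by simp) (u : Gamma0 (L' * 2 ^ j) → Fin 1 → K))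
    {U : SL(2, ℤ)} (hU : (U : Matrix (Fin 2) (Fin 2) ℤ) = !![1, 0; (L' : ℤ) * 2 ^ (j - 1), 1]) (γ : Gamma0 (L' * 2 ^ j)) :
    (u : Gamma0 (L' * 2 ^ j) → Fin 1 → K)
        ⟨U * (γ : SL(2, ℤ)) * U⁻¹, (mem_Gamma0_iff_lowerUnip_conj hU (level_eq_two_mul L' j (by omega))
          (two_dvd_half_level L' j hj) γ).mp γ.2⟩ =
      (u : Gamma0 (L' * 2 ^ j) → Fin 1 → K) γ := by
  classical
  have hN := level_eq_two_mul L' j (by omega : 1 ≤ j)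
  have hx := two_dvd_half_level L' j hj
  haveI : NeZero (L' * 2 ^ j) := ⟨Nat.mul_ne_zero (NeZero.ne L') (pow_ne_zero _ two_ne_zero)⟩
  have h2S : 2 ∈ S := hS 2 Nat.prime_two (dvd_mul_of_dvd_left (dvd_mul_left 2 p) _)
  set uf : Gamma0 (L' * 2 ^ j) → Fin 1 → K := (u : Gamma0 (L' * 2 ^ j) → Fin 1 → K) with huf
  have hu : uf ∈ cocycles 0 (L' * 2 ^ j) K := u.2
  -- GOODness of `ι U ∈ Δ_2(L′)`
  have hsh2 := apply_eq_of_shiftInvariant_d hshift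
  have hsh1 : ∀ γ γ' : Gamma0 (L' * 2 ^ j), ((γ' : SL(2, ℤ)) 0 0 = (γ : SL(2, ℤ)) 0 0 ∧
      (γ' : SL(2, ℤ)) 0 1 = (2 : ℤ) ^ 1 * (γ : SL(2, ℤ)) 0 1 ∧ (2 : ℤ) ^ 1 * (γ' : SL(2, ℤ)) 1 0 = (γ : SL(2, ℤ)) 1 0 ∧
      (γ' : SL(2, ℤ)) 1 1 = (γ : SL(2, ℤ)) 1 1) → uf γ' = uf γ := by
    intro γ γ' hR
    rw [pow_one] at hR
    exact hsh2 γ γ' (by exact_mod_cast hR)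
  have hιU : ConjSpanGenAllLevels.iota 2 U ∈ Delta 2 L' := by
    refine ⟨((2 : ℤ) ^ (j - 1) : Away 2), ?_⟩
    rw [ConjSpanGenAllLevels.iota_apply, hU]
    simp
  obtain ⟨e, hgood⟩ := exists_good_of_mem_Delta 2 1 j L' uf Nat.prime_two le_rfl (by ring) hL' hu hsh1 hιU
  -- the difference cocycle
  have hv := adLowerUnip_mem_cocycles hU hN hx hu
  set c : cocycles 0 (L' * 2 ^ j) K := ⟨_, hv⟩ - u with hc
  have hcoe : (c : Gamma0 (L' * 2 ^ j) → Fin 1 → K) =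
      (fun δ : Gamma0 (L' * 2 ^ j) ↦ uf ⟨U * (δ : SL(2, ℤ)) * U⁻¹, (mem_Gamma0_iff_lowerUnip_conj hU hN hx δ).mp δ.2⟩) - uf := by
    rw [hc, Submodule.coe_sub]
  -- it kills `Γ(2^e)`
  haveI : NeZero (2 ^ e) := ⟨pow_ne_zero _ two_ne_zero⟩
  have hkill : ∀ γ : Gamma0 (L' * 2 ^ j),
      (∀ i k, ((gmat γ i k : ℤ) : ZMod (2 ^ e)) = (((1 : Matrix (Fin 2) (Fin 2) ℤ) i k : ℤ) : ZMod (2 ^ e))) →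
        (c : Gamma0 (L' * 2 ^ j) → Fin 1 → K) γ = 0 := by
    intro γ hγ
    have hmem : (γ : SL(2, ℤ)) ∈ Gamma (2 ^ e) := by
      rw [Gamma_mem]
      refine ⟨?_, ?_, ?_, ?_⟩
      · have h := hγ 0 0; simpa using h
      · have h := hγ 0 1; simpa using h
      · have h := hγ 1 0; simpa using h
      · have h := hγ 1 1; simpa using h
    obtain ⟨γ', hγ', -, huγ'⟩ := hgood e le_rfl γ hmem
    have hγ'eq : (γ' : SL(2, ℤ)) = U * (γ : SL(2, ℤ)) * U⁻¹ := by
      apply iota_injective two_ne_zero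
      rw [hγ', map_mul, map_mul, map_inv]
    rw [hcoe, Pi.sub_apply, sub_eq_zero]
    show uf _ = uf γ
    rw [← huγ']
    congr 1
    exact Subtype.ext hγ'eq.symm
  -- LEMMA C + hNT + gen-eigen
  obtain ⟨r, hr, hrS, hrM, hlam⟩ := hNT e
  haveI : NeZero r := ⟨hr.ne_zero⟩
  have hSN : ∀ q : ℕ, q.Prime → q ∣ L' * 2 ^ j → q ∈ S := by
    intro q hq hqd
    rcases (Nat.Prime.dvd_mul hq).mp hqd with h | h
    · exact hS q hq (h.mul_left _)
    · have := (Nat.prime_dvd_prime_iff_eq hq Nat.prime_two).mp (hq.dvd_of_dvd_pow h)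
      subst this; exact h2S
  have hrN : ¬ r ∣ L' * 2 ^ j := fun hd ↦ hrS (hSN r hr hd)
  have hC := heckeU_eq_smul_of_kills_congruence hr c.2 hkill hrN hrM
  have hT : heckeUZ 0 (L' * 2 ^ j) K hr c = ((r : K) + 1) • c := by
    apply Subtype.ext
    rw [coe_heckeUZ, Submodule.coe_smul, hC]
  have hgen_c : c ∈ Module.End.maxGenEigenspace (heckeUZ 0 (L' * 2 ^ j) K hr) (lam r) := by
    rw [hc]
    exact Submodule.sub_mem _ (isHeckeGenEigenvector_adLowerUnip hU hN hx h2S hgen r hr hrS) (hgen r hr hrS)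
  have hc0 : c = 0 := by
    by_contra hne
    exact hlam (eq_of_apply_eq_smul_of_mem_maxGenEigenspace _ hT hgen_c hne)
  have h0 := congrFun (congrArg Subtype.val hc0) γ
  rw [hcoe, Pi.sub_apply, Submodule.coe_zero, Pi.zero_apply, sub_eq_zero] at h0
  exact h0

end Stability

end Summit.BirchSwinnertonDyer.BirchSwinnertonDyer.Theorems.ManinLocalTwoThree
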